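import Summits.ValiantsHypothesis.ValiantsHypothesis.Theorems.LacunarySymmetroidMatrixDescartesCensusDoorA34NodeForm

/-!
# `MatrixDescartes` census — DOOR A at `(3,4)`: node form of the determinant for the COMPLEX-NODE classes R2 and R0

HONEST FRAMING.  Object-search cell `pub-symmetroid`, door-A seat `val-sym-door-p3` (g4); item stmt-ValiantsHypothesis-19980
`DoorA34 = PosRootLawAt 3 4 18` is OPEN and asserted nowhere in this file.  The companion file `…CensusDoorA34NodeForm` (seat g2)
records the node form of a `3 × 3` pencil whose letters are combinations of four REAL rank-one matrices `vᵢvᵢᵀ` (Cauchy–Binet,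
class R4 of the cell's «four nodes» dictionary, engine-2 `CUBIC-REREP.md` §7/§13.3).  A generic four-dimensional net of real
symmetric `3 × 3` matrices has four rank-one members over `ℂ`; when some of them are complex they come in conjugate pairs
`w wᵀ`, `w̄ w̄ᵀ` (`w = r + i s`), and a REAL member of their span is `Re(m · w wᵀ) = m_R (r rᵀ − s sᵀ) − m_I (r sᵀ + s rᵀ)`
(`m = m_R + i m_I`).  This file records, for ALL supports and with no `def`, the two remaining real cases as explicit polynomial
identities (`Matrix.det_fin_three` + `ring`) together with their first root-side consequences:

* `det_twoReal_oneConjPair` — class R2 (two real nodes `v₀, v₁`, one conjugate pair `r ± i s`):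
  `det (ℓ₀ v₀v₀ᵀ + ℓ₁ v₁v₁ᵀ + m_R (rrᵀ − ssᵀ) − m_I (rsᵀ + srᵀ))
     = −(m_R² + m_I²) · (D(v₁,r,s)² ℓ₁ + D(v₀,r,s)² ℓ₀) + ℓ₀ ℓ₁ · ((D(v₀,v₁,r)² − D(v₀,v₁,s)²) m_R − 2 D(v₀,v₁,r) D(v₀,v₁,s) m_I)`,
  `D(a,b,c)` the `3 × 3` determinant of three vectors (written out) — Cauchy–Binet over `ℂ` with `det[v, w, w̄] = −2i·det[v, r, s]`;
* `det_twoConjPairs` — class R0 (two conjugate pairs `p ± i q`, `r ± i s`):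
  `det (ℓ_R (ppᵀ − qqᵀ) − ℓ_I (pqᵀ + qpᵀ) + m_R (rrᵀ − ssᵀ) − m_I (rsᵀ + srᵀ))
     = (m_R² + m_I²) · A + (ℓ_R² + ℓ_I²) · B`,
  `A = (D(q,r,s)² − D(p,r,s)²) ℓ_R + 2 D(q,r,s) D(p,r,s) ℓ_I`, `B = (D(p,q,s)² − D(p,q,r)²) m_R + 2 D(p,q,s) D(p,q,r) m_I` —
  the cell's normal form `|m|²·Re(γ ℓ) + |ℓ|²·Re(δ m)` (engine-2 §13.3) with the constants `γ, δ` made explicit;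
* SECTOR LAWS: `det_twoConjPairs_pos` / `_neg` / `_ne_zero_of_sameSign` — in class R0 the determinant has the sign shared by the
  two real 2-forms `A, B` whenever they share a strict sign (so det-roots live where `A · B ≤ 0`), and `det_twoReal_oneConjPair_neg`
  / `_pos` — in class R2, `ℓ₀, ℓ₁ > 0 > B` forces `det < 0` and `ℓ₀, ℓ₁ < 0 < B` forces `det > 0`;
* PENCIL VERSIONS: `pencil_eval_eq_sum_nomial_smul` (regrouping `∑ₗ t^(d l) • ∑ᵢ A i l • Mᵢ = ∑ᵢ ℓᵢ(t) • Mᵢ` for ANY four fixed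
  matrices `Mᵢ`, the node `K`-NOMIALS `ℓᵢ(t) = ∑ₗ A i l t^(d l)` on the same support), `eval_det_pencil_fixedLetters`, and the R0
  root-side statement `eval_det_pencil_twoConjPairs_ne_zero` (no det-root at a `t` where the two real node 2-forms share a strict sign).

Numerical context (seat report `HOME/val-sym-door-p3/g4/`; located numerics, not theorems): every census `(3,4)` row with `≥ 16`
roots converts to one of the three node forms and is an exact solution of the «roots + four nodes» system; classes R2/R0 carry
the census seventeens on `(0,1,4,N)`, `(0,2,5,N)`, `(0,3,7,N)`, `(0,7,19,39)` (R2) and `(0,6,20,29)`, `(0,5,16,23)` (R0).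
Which nets HAVE such letters is NOT proved here; nothing in this file bounds `ζ_sym(3,4)`, decides `DoorA34`, or bears on
`MatrixDescartes` (stmt-ValiantsHypothesis-18050) / `VP ≠ VNP`.

[folklore] Cauchy–Binet; Cayley's four-nodal cubic surface and its real forms (Cayley 1869; Salmon, *Geometry of Three
Dimensions*); elementary polynomial identities.
-/

-- `Summit.ValiantsHypothesis.ValiantsHypothesis.…` repeats a component by the D-0017 layout
-- (single-conjunct summit), which the `dupNamespace` linter flags; the name is mandated.
set_option linter.dupNamespace false

namespace Summit.ValiantsHypothesis.ValiantsHypothesis.Theorems.LacunarySymmetroidMatrixDescartes.Census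

open Polynomial Finset
open scoped BigOperators Polynomial Matrix
open Summit.ValiantsHypothesis.ValiantsHypothesis.Theorems.SymmetroidDescartes (eval_det_pencil)

/-! ## Abstract sign lemmas (the shapes of the two node forms) -/

/-- Shape of the R2 node form: `−m₂·X + ℓ₀ℓ₁·B < 0` when `m₂, X ≥ 0`, `ℓ₀, ℓ₁ > 0 > B`. [folklore] -/
theorem nodeFormR2_neg {ℓ₀ ℓ₁ m₂ X B : ℝ} (hm : 0 ≤ m₂) (hX : 0 ≤ X) (h₀ : 0 < ℓ₀) (h₁ : 0 < ℓ₁) (hB : B < 0) :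
    -m₂ * X + ℓ₀ * ℓ₁ * B < 0 := by
  nlinarith [mul_nonneg hm hX, mul_neg_of_pos_of_neg (mul_pos h₀ h₁) hB]

/-- Shape of the R2 node form: `−m₂·X + ℓ₀ℓ₁·B > 0` when `m₂ ≥ 0 ≥ X`, `ℓ₀, ℓ₁ < 0 < B`. [folklore] -/
theorem nodeFormR2_pos {ℓ₀ ℓ₁ m₂ X B : ℝ} (hm : 0 ≤ m₂) (hX : X ≤ 0) (h₀ : ℓ₀ < 0) (h₁ : ℓ₁ < 0) (hB : 0 < B) :
    0 < -m₂ * X + ℓ₀ * ℓ₁ * B := by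
  nlinarith [mul_nonneg hm (neg_nonneg.mpr hX), mul_pos (mul_pos_of_neg_of_neg h₀ h₁) hB]

/-- Shape of the R0 node form: `m₂·(α ℓ_R + β ℓ_I) + (ℓ_R² + ℓ_I²)·B > 0` when `m₂ ≥ 0` and both `α ℓ_R + β ℓ_I` and `B`
are positive (the first forces `(ℓ_R, ℓ_I) ≠ 0`). [folklore] -/
theorem nodeFormR0_pos {lR lI m₂ α β B : ℝ} (hm : 0 ≤ m₂) (hA : 0 < α * lR + β * lI) (hB : 0 < B) :
    0 < m₂ * (α * lR + β * lI) + (lR ^ 2 + lI ^ 2) * B := by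
  have hl : 0 < lR ^ 2 + lI ^ 2 := by
    by_contra h
    have h0 : lR ^ 2 + lI ^ 2 = 0 := le_antisymm (not_lt.mp h) (by positivity)
    have hR : lR = 0 := by nlinarith [sq_nonneg lR, sq_nonneg lI]
    have hI : lI = 0 := by nlinarith [sq_nonneg lR, sq_nonneg lI]
    subst hR; subst hI
    simp at hA
  nlinarith [mul_nonneg hm hA.le, mul_pos hl hB]

/-- Shape of the R0 node form, negative side. [folklore] -/
theorem nodeFormR0_neg {lR lI m₂ α β B : ℝ} (hm : 0 ≤ m₂) (hA : α * lR + β * lI < 0) (hB : B < 0) :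
    m₂ * (α * lR + β * lI) + (lR ^ 2 + lI ^ 2) * B < 0 := by
  have h := nodeFormR0_pos (lR := lR) (lI := lI) (m₂ := m₂) (α := -α) (β := -β) (B := -B) hm (by linarith) (by linarith)
  nlinarith [h]

/-! ## Class R2: two real nodes and one conjugate pair -/

/-- **Node form, class R2.**  For `v₀, v₁, r, s ∈ ℝ³` and real `ℓ₀, ℓ₁, m_R, m_I`,
`det (ℓ₀ v₀v₀ᵀ + ℓ₁ v₁v₁ᵀ + m_R (rrᵀ − ssᵀ) − m_I (rsᵀ + srᵀ))`
`= −(m_R² + m_I²)(D(v₁,r,s)² ℓ₁ + D(v₀,r,s)² ℓ₀) + ℓ₀ℓ₁((D(v₀,v₁,r)² − D(v₀,v₁,s)²) m_R − 2 D(v₀,v₁,r) D(v₀,v₁,s) m_I)`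
with the `3 × 3` determinants `D` written out (Cauchy–Binet over `ℂ` for the letters `ℓ₀, ℓ₁, m/2, m̄/2` at the vectors
`v₀, v₁, r + is, r − is`).  A polynomial identity in `16` variables. [folklore] -/
theorem det_twoReal_oneConjPair (v₀ v₁ r s : Fin 3 → ℝ) (ℓ₀ ℓ₁ mR mI : ℝ) :
    (ℓ₀ • Matrix.vecMulVec v₀ v₀ + ℓ₁ • Matrix.vecMulVec v₁ v₁
        + mR • (Matrix.vecMulVec r r - Matrix.vecMulVec s s) - mI • (Matrix.vecMulVec r s + Matrix.vecMulVec s r)).det =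
      -(mR ^ 2 + mI ^ 2) *
          ((v₁ 0 * (r 1 * s 2 - r 2 * s 1) - v₁ 1 * (r 0 * s 2 - r 2 * s 0) + v₁ 2 * (r 0 * s 1 - r 1 * s 0)) ^ 2 * ℓ₁
            + (v₀ 0 * (r 1 * s 2 - r 2 * s 1) - v₀ 1 * (r 0 * s 2 - r 2 * s 0) + v₀ 2 * (r 0 * s 1 - r 1 * s 0)) ^ 2 * ℓ₀)
        + ℓ₀ * ℓ₁ *
          (((v₀ 0 * (v₁ 1 * r 2 - v₁ 2 * r 1) - v₀ 1 * (v₁ 0 * r 2 - v₁ 2 * r 0) + v₀ 2 * (v₁ 0 * r 1 - v₁ 1 * r 0)) ^ 2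
              - (v₀ 0 * (v₁ 1 * s 2 - v₁ 2 * s 1) - v₀ 1 * (v₁ 0 * s 2 - v₁ 2 * s 0) + v₀ 2 * (v₁ 0 * s 1 - v₁ 1 * s 0)) ^ 2) * mR
            - 2 * (v₀ 0 * (v₁ 1 * r 2 - v₁ 2 * r 1) - v₀ 1 * (v₁ 0 * r 2 - v₁ 2 * r 0) + v₀ 2 * (v₁ 0 * r 1 - v₁ 1 * r 0))
                * (v₀ 0 * (v₁ 1 * s 2 - v₁ 2 * s 1) - v₀ 1 * (v₁ 0 * s 2 - v₁ 2 * s 0) + v₀ 2 * (v₁ 0 * s 1 - v₁ 1 * s 0)) * mI) := by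
  rw [Matrix.det_fin_three]
  simp only [Matrix.add_apply, Matrix.sub_apply, Matrix.smul_apply, Matrix.vecMulVec_apply, smul_eq_mul]
  ring

/-- **Sector law, class R2 (i).**  If `ℓ₀, ℓ₁ > 0` and the real node 2-form of the conjugate pair is negative,
`(D(v₀,v₁,r)² − D(v₀,v₁,s)²) m_R − 2 D(v₀,v₁,r) D(v₀,v₁,s) m_I < 0`, then the determinant is negative. [folklore] -/
theorem det_twoReal_oneConjPair_neg (v₀ v₁ r s : Fin 3 → ℝ) (ℓ₀ ℓ₁ mR mI : ℝ) (h₀ : 0 < ℓ₀) (h₁ : 0 < ℓ₁)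
    (hB : ((v₀ 0 * (v₁ 1 * r 2 - v₁ 2 * r 1) - v₀ 1 * (v₁ 0 * r 2 - v₁ 2 * r 0) + v₀ 2 * (v₁ 0 * r 1 - v₁ 1 * r 0)) ^ 2
              - (v₀ 0 * (v₁ 1 * s 2 - v₁ 2 * s 1) - v₀ 1 * (v₁ 0 * s 2 - v₁ 2 * s 0) + v₀ 2 * (v₁ 0 * s 1 - v₁ 1 * s 0)) ^ 2) * mR
            - 2 * (v₀ 0 * (v₁ 1 * r 2 - v₁ 2 * r 1) - v₀ 1 * (v₁ 0 * r 2 - v₁ 2 * r 0) + v₀ 2 * (v₁ 0 * r 1 - v₁ 1 * r 0))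
                * (v₀ 0 * (v₁ 1 * s 2 - v₁ 2 * s 1) - v₀ 1 * (v₁ 0 * s 2 - v₁ 2 * s 0) + v₀ 2 * (v₁ 0 * s 1 - v₁ 1 * s 0)) * mI
          < 0) :
    (ℓ₀ • Matrix.vecMulVec v₀ v₀ + ℓ₁ • Matrix.vecMulVec v₁ v₁
        + mR • (Matrix.vecMulVec r r - Matrix.vecMulVec s s) - mI • (Matrix.vecMulVec r s + Matrix.vecMulVec s r)).det < 0 := by
  rw [det_twoReal_oneConjPair]
  exact nodeFormR2_neg (by positivity) (by positivity) h₀ h₁ hB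

/-- **Sector law, class R2 (ii).**  If `ℓ₀, ℓ₁ < 0` and the real node 2-form of the conjugate pair is positive, then the
determinant is positive. [folklore] -/
theorem det_twoReal_oneConjPair_pos (v₀ v₁ r s : Fin 3 → ℝ) (ℓ₀ ℓ₁ mR mI : ℝ) (h₀ : ℓ₀ < 0) (h₁ : ℓ₁ < 0)
    (hB : 0 < ((v₀ 0 * (v₁ 1 * r 2 - v₁ 2 * r 1) - v₀ 1 * (v₁ 0 * r 2 - v₁ 2 * r 0) + v₀ 2 * (v₁ 0 * r 1 - v₁ 1 * r 0)) ^ 2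
              - (v₀ 0 * (v₁ 1 * s 2 - v₁ 2 * s 1) - v₀ 1 * (v₁ 0 * s 2 - v₁ 2 * s 0) + v₀ 2 * (v₁ 0 * s 1 - v₁ 1 * s 0)) ^ 2) * mR
            - 2 * (v₀ 0 * (v₁ 1 * r 2 - v₁ 2 * r 1) - v₀ 1 * (v₁ 0 * r 2 - v₁ 2 * r 0) + v₀ 2 * (v₁ 0 * r 1 - v₁ 1 * r 0))
                * (v₀ 0 * (v₁ 1 * s 2 - v₁ 2 * s 1) - v₀ 1 * (v₁ 0 * s 2 - v₁ 2 * s 0) + v₀ 2 * (v₁ 0 * s 1 - v₁ 1 * s 0)) * mI) :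
    0 < (ℓ₀ • Matrix.vecMulVec v₀ v₀ + ℓ₁ • Matrix.vecMulVec v₁ v₁
        + mR • (Matrix.vecMulVec r r - Matrix.vecMulVec s s) - mI • (Matrix.vecMulVec r s + Matrix.vecMulVec s r)).det := by
  rw [det_twoReal_oneConjPair]
  refine nodeFormR2_pos (by positivity) ?_ h₀ h₁ hB
  have a₁ := mul_nonpos_of_nonneg_of_nonpos (sq_nonneg (v₁ 0 * (r 1 * s 2 - r 2 * s 1) - v₁ 1 * (r 0 * s 2 - r 2 * s 0)
    + v₁ 2 * (r 0 * s 1 - r 1 * s 0))) h₁.le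
  have a₀ := mul_nonpos_of_nonneg_of_nonpos (sq_nonneg (v₀ 0 * (r 1 * s 2 - r 2 * s 1) - v₀ 1 * (r 0 * s 2 - r 2 * s 0)
    + v₀ 2 * (r 0 * s 1 - r 1 * s 0))) h₀.le
  linarith

/-! ## Class R0: two conjugate pairs -/

/-- **Node form, class R0.**  For `p, q, r, s ∈ ℝ³` and real `ℓ_R, ℓ_I, m_R, m_I`,
`det (ℓ_R (ppᵀ − qqᵀ) − ℓ_I (pqᵀ + qpᵀ) + m_R (rrᵀ − ssᵀ) − m_I (rsᵀ + srᵀ)) = (m_R² + m_I²) · A + (ℓ_R² + ℓ_I²) · B` with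
`A = (D(q,r,s)² − D(p,r,s)²) ℓ_R + 2 D(q,r,s) D(p,r,s) ℓ_I` and `B = (D(p,q,s)² − D(p,q,r)²) m_R + 2 D(p,q,s) D(p,q,r) m_I`
(Cauchy–Binet over `ℂ` for the letters `ℓ/2, ℓ̄/2, m/2, m̄/2` at `p ± iq`, `r ± is`; the cell's `|m|² Re(γℓ) + |ℓ|² Re(δm)`
with `γ, δ` explicit).  A polynomial identity in `16` variables. [folklore] -/
theorem det_twoConjPairs (p q r s : Fin 3 → ℝ) (lR lI mR mI : ℝ) :
    (lR • (Matrix.vecMulVec p p - Matrix.vecMulVec q q) - lI • (Matrix.vecMulVec p q + Matrix.vecMulVec q p)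
        + mR • (Matrix.vecMulVec r r - Matrix.vecMulVec s s) - mI • (Matrix.vecMulVec r s + Matrix.vecMulVec s r)).det =
      (mR ^ 2 + mI ^ 2) *
          (((q 0 * (r 1 * s 2 - r 2 * s 1) - q 1 * (r 0 * s 2 - r 2 * s 0) + q 2 * (r 0 * s 1 - r 1 * s 0)) ^ 2
              - (p 0 * (r 1 * s 2 - r 2 * s 1) - p 1 * (r 0 * s 2 - r 2 * s 0) + p 2 * (r 0 * s 1 - r 1 * s 0)) ^ 2) * lR
            + 2 * (q 0 * (r 1 * s 2 - r 2 * s 1) - q 1 * (r 0 * s 2 - r 2 * s 0) + q 2 * (r 0 * s 1 - r 1 * s 0))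
                * (p 0 * (r 1 * s 2 - r 2 * s 1) - p 1 * (r 0 * s 2 - r 2 * s 0) + p 2 * (r 0 * s 1 - r 1 * s 0)) * lI)
        + (lR ^ 2 + lI ^ 2) *
          (((p 0 * (q 1 * s 2 - q 2 * s 1) - p 1 * (q 0 * s 2 - q 2 * s 0) + p 2 * (q 0 * s 1 - q 1 * s 0)) ^ 2
              - (p 0 * (q 1 * r 2 - q 2 * r 1) - p 1 * (q 0 * r 2 - q 2 * r 0) + p 2 * (q 0 * r 1 - q 1 * r 0)) ^ 2) * mR
            + 2 * (p 0 * (q 1 * s 2 - q 2 * s 1) - p 1 * (q 0 * s 2 - q 2 * s 0) + p 2 * (q 0 * s 1 - q 1 * s 0))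
                * (p 0 * (q 1 * r 2 - q 2 * r 1) - p 1 * (q 0 * r 2 - q 2 * r 0) + p 2 * (q 0 * r 1 - q 1 * r 0)) * mI) := by
  rw [Matrix.det_fin_three]
  simp only [Matrix.add_apply, Matrix.sub_apply, Matrix.smul_apply, Matrix.vecMulVec_apply, smul_eq_mul]
  ring

/-- **Sector law, class R0 (i)**: if both real node 2-forms `A`, `B` of `det_twoConjPairs` are positive, the determinant is
positive (note `A > 0` forces `(ℓ_R, ℓ_I) ≠ 0`). [folklore] -/
theorem det_twoConjPairs_pos (p q r s : Fin 3 → ℝ) (lR lI mR mI : ℝ)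
    (hA : 0 < ((q 0 * (r 1 * s 2 - r 2 * s 1) - q 1 * (r 0 * s 2 - r 2 * s 0) + q 2 * (r 0 * s 1 - r 1 * s 0)) ^ 2
              - (p 0 * (r 1 * s 2 - r 2 * s 1) - p 1 * (r 0 * s 2 - r 2 * s 0) + p 2 * (r 0 * s 1 - r 1 * s 0)) ^ 2) * lR
            + 2 * (q 0 * (r 1 * s 2 - r 2 * s 1) - q 1 * (r 0 * s 2 - r 2 * s 0) + q 2 * (r 0 * s 1 - r 1 * s 0))
                * (p 0 * (r 1 * s 2 - r 2 * s 1) - p 1 * (r 0 * s 2 - r 2 * s 0) + p 2 * (r 0 * s 1 - r 1 * s 0)) * lI)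
    (hB : 0 < ((p 0 * (q 1 * s 2 - q 2 * s 1) - p 1 * (q 0 * s 2 - q 2 * s 0) + p 2 * (q 0 * s 1 - q 1 * s 0)) ^ 2
              - (p 0 * (q 1 * r 2 - q 2 * r 1) - p 1 * (q 0 * r 2 - q 2 * r 0) + p 2 * (q 0 * r 1 - q 1 * r 0)) ^ 2) * mR
            + 2 * (p 0 * (q 1 * s 2 - q 2 * s 1) - p 1 * (q 0 * s 2 - q 2 * s 0) + p 2 * (q 0 * s 1 - q 1 * s 0))
                * (p 0 * (q 1 * r 2 - q 2 * r 1) - p 1 * (q 0 * r 2 - q 2 * r 0) + p 2 * (q 0 * r 1 - q 1 * r 0)) * mI) :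
    0 < (lR • (Matrix.vecMulVec p p - Matrix.vecMulVec q q) - lI • (Matrix.vecMulVec p q + Matrix.vecMulVec q p)
        + mR • (Matrix.vecMulVec r r - Matrix.vecMulVec s s) - mI • (Matrix.vecMulVec r s + Matrix.vecMulVec s r)).det := by
  rw [det_twoConjPairs]
  exact nodeFormR0_pos (by positivity) hA hB

/-- **Sector law, class R0 (ii)**: if both real node 2-forms are negative, the determinant is negative. [folklore] -/
theorem det_twoConjPairs_neg (p q r s : Fin 3 → ℝ) (lR lI mR mI : ℝ)
    (hA : ((q 0 * (r 1 * s 2 - r 2 * s 1) - q 1 * (r 0 * s 2 - r 2 * s 0) + q 2 * (r 0 * s 1 - r 1 * s 0)) ^ 2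
              - (p 0 * (r 1 * s 2 - r 2 * s 1) - p 1 * (r 0 * s 2 - r 2 * s 0) + p 2 * (r 0 * s 1 - r 1 * s 0)) ^ 2) * lR
            + 2 * (q 0 * (r 1 * s 2 - r 2 * s 1) - q 1 * (r 0 * s 2 - r 2 * s 0) + q 2 * (r 0 * s 1 - r 1 * s 0))
                * (p 0 * (r 1 * s 2 - r 2 * s 1) - p 1 * (r 0 * s 2 - r 2 * s 0) + p 2 * (r 0 * s 1 - r 1 * s 0)) * lI < 0)
    (hB : ((p 0 * (q 1 * s 2 - q 2 * s 1) - p 1 * (q 0 * s 2 - q 2 * s 0) + p 2 * (q 0 * s 1 - q 1 * s 0)) ^ 2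
              - (p 0 * (q 1 * r 2 - q 2 * r 1) - p 1 * (q 0 * r 2 - q 2 * r 0) + p 2 * (q 0 * r 1 - q 1 * r 0)) ^ 2) * mR
            + 2 * (p 0 * (q 1 * s 2 - q 2 * s 1) - p 1 * (q 0 * s 2 - q 2 * s 0) + p 2 * (q 0 * s 1 - q 1 * s 0))
                * (p 0 * (q 1 * r 2 - q 2 * r 1) - p 1 * (q 0 * r 2 - q 2 * r 0) + p 2 * (q 0 * r 1 - q 1 * r 0)) * mI < 0) :
    (lR • (Matrix.vecMulVec p p - Matrix.vecMulVec q q) - lI • (Matrix.vecMulVec p q + Matrix.vecMulVec q p)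
        + mR • (Matrix.vecMulVec r r - Matrix.vecMulVec s s) - mI • (Matrix.vecMulVec r s + Matrix.vecMulVec s r)).det < 0 := by
  rw [det_twoConjPairs]
  exact nodeFormR0_neg (by positivity) hA hB

/-- **No zero in a same-sign chamber, class R0**: if the two real node 2-forms share a strict sign, the determinant is
non-zero — det-roots of an R0 net live where the two forms have opposite signs (or one vanishes). [folklore] -/
theorem det_twoConjPairs_ne_zero_of_sameSign (p q r s : Fin 3 → ℝ) (lR lI mR mI : ℝ)
    (h : (0 < ((q 0 * (r 1 * s 2 - r 2 * s 1) - q 1 * (r 0 * s 2 - r 2 * s 0) + q 2 * (r 0 * s 1 - r 1 * s 0)) ^ 2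
              - (p 0 * (r 1 * s 2 - r 2 * s 1) - p 1 * (r 0 * s 2 - r 2 * s 0) + p 2 * (r 0 * s 1 - r 1 * s 0)) ^ 2) * lR
            + 2 * (q 0 * (r 1 * s 2 - r 2 * s 1) - q 1 * (r 0 * s 2 - r 2 * s 0) + q 2 * (r 0 * s 1 - r 1 * s 0))
                * (p 0 * (r 1 * s 2 - r 2 * s 1) - p 1 * (r 0 * s 2 - r 2 * s 0) + p 2 * (r 0 * s 1 - r 1 * s 0)) * lI
          ∧ 0 < ((p 0 * (q 1 * s 2 - q 2 * s 1) - p 1 * (q 0 * s 2 - q 2 * s 0) + p 2 * (q 0 * s 1 - q 1 * s 0)) ^ 2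
              - (p 0 * (q 1 * r 2 - q 2 * r 1) - p 1 * (q 0 * r 2 - q 2 * r 0) + p 2 * (q 0 * r 1 - q 1 * r 0)) ^ 2) * mR
            + 2 * (p 0 * (q 1 * s 2 - q 2 * s 1) - p 1 * (q 0 * s 2 - q 2 * s 0) + p 2 * (q 0 * s 1 - q 1 * s 0))
                * (p 0 * (q 1 * r 2 - q 2 * r 1) - p 1 * (q 0 * r 2 - q 2 * r 0) + p 2 * (q 0 * r 1 - q 1 * r 0)) * mI)
        ∨ (((q 0 * (r 1 * s 2 - r 2 * s 1) - q 1 * (r 0 * s 2 - r 2 * s 0) + q 2 * (r 0 * s 1 - r 1 * s 0)) ^ 2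
              - (p 0 * (r 1 * s 2 - r 2 * s 1) - p 1 * (r 0 * s 2 - r 2 * s 0) + p 2 * (r 0 * s 1 - r 1 * s 0)) ^ 2) * lR
            + 2 * (q 0 * (r 1 * s 2 - r 2 * s 1) - q 1 * (r 0 * s 2 - r 2 * s 0) + q 2 * (r 0 * s 1 - r 1 * s 0))
                * (p 0 * (r 1 * s 2 - r 2 * s 1) - p 1 * (r 0 * s 2 - r 2 * s 0) + p 2 * (r 0 * s 1 - r 1 * s 0)) * lI < 0
          ∧ ((p 0 * (q 1 * s 2 - q 2 * s 1) - p 1 * (q 0 * s 2 - q 2 * s 0) + p 2 * (q 0 * s 1 - q 1 * s 0)) ^ 2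
              - (p 0 * (q 1 * r 2 - q 2 * r 1) - p 1 * (q 0 * r 2 - q 2 * r 0) + p 2 * (q 0 * r 1 - q 1 * r 0)) ^ 2) * mR
            + 2 * (p 0 * (q 1 * s 2 - q 2 * s 1) - p 1 * (q 0 * s 2 - q 2 * s 0) + p 2 * (q 0 * s 1 - q 1 * s 0))
                * (p 0 * (q 1 * r 2 - q 2 * r 1) - p 1 * (q 0 * r 2 - q 2 * r 0) + p 2 * (q 0 * r 1 - q 1 * r 0)) * mI < 0)) :
    (lR • (Matrix.vecMulVec p p - Matrix.vecMulVec q q) - lI • (Matrix.vecMulVec p q + Matrix.vecMulVec q p)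
        + mR • (Matrix.vecMulVec r r - Matrix.vecMulVec s s) - mI • (Matrix.vecMulVec r s + Matrix.vecMulVec s r)).det ≠ 0 := by
  rcases h with ⟨hA, hB⟩ | ⟨hA, hB⟩
  · exact ne_of_gt (det_twoConjPairs_pos p q r s lR lI mR mI hA hB)
  · exact ne_of_lt (det_twoConjPairs_neg p q r s lR lI mR mI hA hB)

/-! ## Pencils whose letters are combinations of four fixed matrices -/

/-- Regrouping by nodes for ANY four fixed matrices `Mᵢ`: `∑ₗ t^(d l) • (∑ᵢ A i l • Mᵢ) = ∑ᵢ ℓᵢ(t) • Mᵢ` with the node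
`K`-nomials `ℓᵢ(t) = ∑ₗ A i l · t^(d l)` on the SAME support (the R4 file states this for `Mᵢ = vᵢvᵢᵀ`). [folklore] -/
theorem pencil_eval_eq_sum_nomial_smul {K : ℕ} (d : Fin K → ℕ) (A : Fin 4 → Fin K → ℝ)
    (M : Fin 4 → Matrix (Fin 3) (Fin 3) ℝ) (t : ℝ) :
    (∑ l, t ^ d l • ∑ i, A i l • M i) = ∑ i, (∑ l, A i l * t ^ d l) • M i := by
  simp only [Finset.smul_sum, smul_smul, Finset.sum_smul]
  rw [Finset.sum_comm]
  refine Finset.sum_congr rfl fun i _ => Finset.sum_congr rfl fun l _ => ?_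
  rw [mul_comm]

/-- `det F(t)` of a pencil whose letters are combinations `S l = ∑ᵢ A i l • Mᵢ` of four fixed matrices is the determinant of
`∑ᵢ ℓᵢ(t) • Mᵢ`. [folklore] -/
theorem eval_det_pencil_fixedLetters {K : ℕ} (d : Fin K → ℕ) (A : Fin 4 → Fin K → ℝ)
    (M : Fin 4 → Matrix (Fin 3) (Fin 3) ℝ) (t : ℝ) :
    ((∑ l, (X : ℝ[X]) ^ d l • (∑ i, A i l • M i).map C).det).eval t = (∑ i, (∑ l, A i l * t ^ d l) • M i).det := by
  rw [eval_det_pencil, pencil_eval_eq_sum_nomial_smul]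

/-- The four real letters of an R0 net in node coordinates: `M₀ = ppᵀ − qqᵀ`, `M₁ = −(pqᵀ + qpᵀ)`, `M₂ = rrᵀ − ssᵀ`,
`M₃ = −(rsᵀ + srᵀ)`; the sum `∑ᵢ ℓᵢ • Mᵢ` is the matrix of `det_twoConjPairs` with `(ℓ_R, ℓ_I, m_R, m_I) = (ℓ₀, ℓ₁, ℓ₂, ℓ₃)`.
[folklore] -/
theorem sum_smul_conjPairLetters (p q r s : Fin 3 → ℝ) (ℓ : Fin 4 → ℝ) :
    (∑ i, ℓ i • (![Matrix.vecMulVec p p - Matrix.vecMulVec q q, -(Matrix.vecMulVec p q + Matrix.vecMulVec q p),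
        Matrix.vecMulVec r r - Matrix.vecMulVec s s, -(Matrix.vecMulVec r s + Matrix.vecMulVec s r)] i)) =
      ℓ 0 • (Matrix.vecMulVec p p - Matrix.vecMulVec q q) - ℓ 1 • (Matrix.vecMulVec p q + Matrix.vecMulVec q p)
        + ℓ 2 • (Matrix.vecMulVec r r - Matrix.vecMulVec s s) - ℓ 3 • (Matrix.vecMulVec r s + Matrix.vecMulVec s r) := by
  simp only [Fin.sum_univ_four, Matrix.cons_val_zero, Matrix.cons_val_one, Matrix.cons_val]
  simp only [smul_neg]
  abel

/-- **No det-root in a same-sign chamber, class R0.**  For a pencil with letters `S l = ∑ᵢ A i l • Mᵢ` over the four real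
R0 letters `Mᵢ` of two conjugate node pairs `p ± iq`, `r ± is`, `det F(t) ≠ 0` at every `t` where the two real node 2-forms
`A(t) = (D(q,r,s)² − D(p,r,s)²) ℓ₀(t) + 2 D(q,r,s) D(p,r,s) ℓ₁(t)` and `B(t) = (D(p,q,s)² − D(p,q,r)²) ℓ₂(t) + 2 D(p,q,s) D(p,q,r) ℓ₃(t)`
share a strict sign (`ℓᵢ(t) = ∑ₗ A i l t^(d l)` the node `K`-nomials). [folklore] -/
theorem eval_det_pencil_twoConjPairs_ne_zero {K : ℕ} (d : Fin K → ℕ) (A : Fin 4 → Fin K → ℝ) (p q r s : Fin 3 → ℝ)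
    (t : ℝ)
    (h : (0 < ((q 0 * (r 1 * s 2 - r 2 * s 1) - q 1 * (r 0 * s 2 - r 2 * s 0) + q 2 * (r 0 * s 1 - r 1 * s 0)) ^ 2
              - (p 0 * (r 1 * s 2 - r 2 * s 1) - p 1 * (r 0 * s 2 - r 2 * s 0) + p 2 * (r 0 * s 1 - r 1 * s 0)) ^ 2)
                * (∑ l, A 0 l * t ^ d l)
            + 2 * (q 0 * (r 1 * s 2 - r 2 * s 1) - q 1 * (r 0 * s 2 - r 2 * s 0) + q 2 * (r 0 * s 1 - r 1 * s 0))
                * (p 0 * (r 1 * s 2 - r 2 * s 1) - p 1 * (r 0 * s 2 - r 2 * s 0) + p 2 * (r 0 * s 1 - r 1 * s 0))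
                * (∑ l, A 1 l * t ^ d l)
          ∧ 0 < ((p 0 * (q 1 * s 2 - q 2 * s 1) - p 1 * (q 0 * s 2 - q 2 * s 0) + p 2 * (q 0 * s 1 - q 1 * s 0)) ^ 2
              - (p 0 * (q 1 * r 2 - q 2 * r 1) - p 1 * (q 0 * r 2 - q 2 * r 0) + p 2 * (q 0 * r 1 - q 1 * r 0)) ^ 2)
                * (∑ l, A 2 l * t ^ d l)
            + 2 * (p 0 * (q 1 * s 2 - q 2 * s 1) - p 1 * (q 0 * s 2 - q 2 * s 0) + p 2 * (q 0 * s 1 - q 1 * s 0))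
                * (p 0 * (q 1 * r 2 - q 2 * r 1) - p 1 * (q 0 * r 2 - q 2 * r 0) + p 2 * (q 0 * r 1 - q 1 * r 0))
                * (∑ l, A 3 l * t ^ d l))
        ∨ (((q 0 * (r 1 * s 2 - r 2 * s 1) - q 1 * (r 0 * s 2 - r 2 * s 0) + q 2 * (r 0 * s 1 - r 1 * s 0)) ^ 2
              - (p 0 * (r 1 * s 2 - r 2 * s 1) - p 1 * (r 0 * s 2 - r 2 * s 0) + p 2 * (r 0 * s 1 - r 1 * s 0)) ^ 2)
                * (∑ l, A 0 l * t ^ d l)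
            + 2 * (q 0 * (r 1 * s 2 - r 2 * s 1) - q 1 * (r 0 * s 2 - r 2 * s 0) + q 2 * (r 0 * s 1 - r 1 * s 0))
                * (p 0 * (r 1 * s 2 - r 2 * s 1) - p 1 * (r 0 * s 2 - r 2 * s 0) + p 2 * (r 0 * s 1 - r 1 * s 0))
                * (∑ l, A 1 l * t ^ d l) < 0
          ∧ ((p 0 * (q 1 * s 2 - q 2 * s 1) - p 1 * (q 0 * s 2 - q 2 * s 0) + p 2 * (q 0 * s 1 - q 1 * s 0)) ^ 2
              - (p 0 * (q 1 * r 2 - q 2 * r 1) - p 1 * (q 0 * r 2 - q 2 * r 0) + p 2 * (q 0 * r 1 - q 1 * r 0)) ^ 2)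
                * (∑ l, A 2 l * t ^ d l)
            + 2 * (p 0 * (q 1 * s 2 - q 2 * s 1) - p 1 * (q 0 * s 2 - q 2 * s 0) + p 2 * (q 0 * s 1 - q 1 * s 0))
                * (p 0 * (q 1 * r 2 - q 2 * r 1) - p 1 * (q 0 * r 2 - q 2 * r 0) + p 2 * (q 0 * r 1 - q 1 * r 0))
                * (∑ l, A 3 l * t ^ d l) < 0)) :
    ((∑ l, (X : ℝ[X]) ^ d l • (∑ i, A i l •
        (![Matrix.vecMulVec p p - Matrix.vecMulVec q q, -(Matrix.vecMulVec p q + Matrix.vecMulVec q p),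
          Matrix.vecMulVec r r - Matrix.vecMulVec s s, -(Matrix.vecMulVec r s + Matrix.vecMulVec s r)] i)).map C).det).eval t
      ≠ 0 := by
  rw [eval_det_pencil_fixedLetters, sum_smul_conjPairLetters]
  exact det_twoConjPairs_ne_zero_of_sameSign p q r s _ _ _ _ h

end Summit.ValiantsHypothesis.ValiantsHypothesis.Theorems.LacunarySymmetroidMatrixDescartes.Census
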